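import Summits.ResolutionOfSingularities.KangarooAtlas.MizutaniAttained
import Summits.ResolutionOfSingularities.KangarooAtlas.MizutaniMultiplicityBridge
import HarnessLib

/-!
# Mizutani's conjecture — the attainment `H_e` in Hironaka's own reading (`U(𝔭) ∩ L`)

Cell topic `Summits/ResolutionOfSingularities/KangarooAtlas` (pub-rosobs); namespace
`Summit.ResolutionOfSingularities.KangarooAtlas.Mizutani`.  AI-written; *AI review is weaker than expert review*;
not a resolution theorem.

`MizutaniAttained.lean` realises Mizutani's extremal scheme `H_e` as the point `attP ⊂ k[X_0..X_{2q−1}]`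
(`k = F(u_0,u_1)`, `X_i ↦ c_i T` with `c_i = u^{W_i}`, `W_i ∈ {0,1} × [0,q)`, scalars through `F^e`) and shows
that ODA's invariant additive forms `(L_B)_e(attP)` are the line `k·a⁰` (`attA0`, the left coefficients of
`ω = t_0 t_1^{q−1}`), exponent exactly `e`, `dim = 2q − 1`.  Here we show that the additive form
`h⁰ = Σ_i a⁰_i X_i^q` has MULTIPLICITY `q = p^e` at `attP`, i.e. lies in Hironaka's `U(attP) ∩ L_e`
(`hirForms`, `MizutaniMultiplicity.lean`): explicitly

  `X_{00}^{q²} · h⁰ ≡ − X_{00}^q · G_{10} · G_{01}^{q−1}  (mod attP^q)`,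

where `G_{10} = X_{10}^q − u_0 X_{00}^q`, `G_{01} = X_{01}^q − u_1 X_{00}^q ∈ attP`, using the binomials
`X_{εj} X_{00}^j − X_{10}^ε X_{01}^j X_{00}^{1−ε} ∈ attP` and the geometric-sum identity
`Σ_j a^j b^{q−1−j} = (a − b)^{q−1}` in characteristic `p`.  Consequences:

* **`attA0_mem_hirForms`** — `a⁰ ∈ U(attP) ∩ L_e`;
* **`hirForms_attP_eq`** — `U(attP) ∩ L_j = (L_B)_j(attP)` at EVERY level `j` (levels `≥ e`: one-dimensional on
  both sides; levels `< e`: both zero, `invForms_attP_eq_bot_of_lt`);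
* **`mizutaniAttained_hirForms`** — the ATTAINMENT half of Mizutani's conjecture holds for a point at which Oda's
  `(L_B)` and Hironaka's `U(𝔭) ∩ L` coincide at all levels: Mizutani's `H_e` has exponent `e` and dimension
  `2p^e − 1` ALSO in Hironaka's/Mizutani's own reading (Mizutani 1973 §1 (c)), unconditionally.

References: [Mizutani1973HironakaGroupSchemes] §1 (Def. 1.1, (c)), Remark 2.10, Example 2.1;
[Oda1983HironakaGroupSchemeII] §2 (p. 1168).
-/

open MvPolynomial Literature.AlgebraicGeometry.Resolution
  Literature.AlgebraicGeometry.Resolution.HironakaScheme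

namespace Summit.ResolutionOfSingularities.KangarooAtlas.Mizutani

universe u

section Attained

variable {F : Type u} [Field F] {p e : ℕ} [hp : Fact p.Prime] [CharP F p]

/-- `attP` is prime. [folklore] -/
theorem attP_isPrime : (attP F p e).IsPrime := (isPoint_attP (F := F) (p := p) (e := e)).1

omit [CharP F p] in
/-- The monomial `c_{(ε,j)} = u_0^ε u_1^j`. [folklore] -/
theorem attC_symm_apply (ε : Fin 2) (j : Fin (p ^ e)) :
    attC F p e ((attIdx p e).symm (ε, j)) = ratGen F 2 0 ^ (ε : ℕ) * ratGen F 2 1 ^ (j : ℕ) := by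
  unfold attC
  rw [Fin.prod_univ_two, attW_zero, attW_one, Equiv.apply_symm_apply]

/-- `attPsi (X_i) = c_i · T`. [folklore] -/
theorem attPsi_X (i : Fin (attN p e + 1)) :
    attPsi F p e (X i) = Polynomial.C (attC F p e i) * Polynomial.X := by
  unfold attPsi attXi
  rw [eval₂Hom_X']

/-- `attPsi (C c) = c^{p^e}` (scalars through `F^e`). [folklore] -/
theorem attPsi_C (c : RatField F 2) : attPsi F p e (C c) = Polynomial.C (c ^ p ^ e) := by
  unfold attPsi
  rw [eval₂Hom_C, RingHom.comp_apply, iterateFrobenius_def]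

/-- Membership in `attP` is the vanishing of `attPsi`. [folklore] -/
theorem mem_attP_iff (f : MvPolynomial (Fin (attN p e + 1)) (RatField F 2)) :
    f ∈ attP F p e ↔ attPsi F p e f = 0 := by
  unfold attP; rw [RingHom.mem_ker]

variable (F p e) in
/-- The index of the monomial `c = 1` (`W = (0,0)`). [folklore] -/
def att00 : Fin (attN p e + 1) := (attIdx p e).symm (0, ⟨0, pow_pos hp.out.pos e⟩)

variable (F p e) in
/-- The index of the monomial `c = u_0` (`W = (1,0)`). [folklore] -/
def att10 : Fin (attN p e + 1) := (attIdx p e).symm (1, ⟨0, pow_pos hp.out.pos e⟩)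

/-- The index of the monomial `c = u_1` (`W = (0,1)`; needs `q ≥ 2`). [folklore] -/
def att01 (he : 1 ≤ e) : Fin (attN p e + 1) :=
  (attIdx p e).symm (0, ⟨1, lt_of_lt_of_le hp.out.one_lt (by simpa using Nat.pow_le_pow_right hp.out.pos he)⟩)

omit [CharP F p] in
/-- `c_{00} = 1`. [folklore] -/
theorem attC_att00 : attC F p e (att00 p e) = 1 := by
  unfold att00; rw [attC_symm_apply]; simp

omit [CharP F p] in
/-- `c_{10} = u_0`. [folklore] -/
theorem attC_att10 : attC F p e (att10 p e) = ratGen F 2 0 := by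
  unfold att10; rw [attC_symm_apply]; simp

omit [CharP F p] in
/-- `c_{01} = u_1`. [folklore] -/
theorem attC_att01 (he : 1 ≤ e) : attC F p e (att01 (p := p) he) = ratGen F 2 1 := by
  unfold att01; rw [attC_symm_apply]; simp

/-- `X_{00} ∉ attP`. [folklore] -/
theorem X_att00_not_mem : (X (att00 p e) : MvPolynomial (Fin (attN p e + 1)) (RatField F 2)) ∉ attP F p e := by
  rw [mem_attP_iff, attPsi_X, attC_att00, map_one, one_mul]
  exact Polynomial.X_ne_zero

/-- The toric binomial `X_{(0,j)} X_{00}^j − X_{01}^j X_{00} ∈ attP`. [folklore] -/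
theorem binom0_mem (he : 1 ≤ e) (j : Fin (p ^ e)) :
    X ((attIdx p e).symm (0, j)) * X (att00 p e) ^ (j : ℕ) - X (att01 (p := p) he) ^ (j : ℕ) * X (att00 p e)
      ∈ attP F p e := by
  rw [mem_attP_iff, map_sub, map_mul, map_mul, map_pow, map_pow, attPsi_X, attPsi_X, attPsi_X, attC_symm_apply,
    attC_att00, attC_att01]
  simp only [Fin.val_zero, pow_zero, one_mul, map_one, map_pow, mul_pow]
  ring

/-- The toric binomial `X_{(1,j)} X_{00}^j − X_{10} X_{01}^j ∈ attP`. [folklore] -/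
theorem binom1_mem (he : 1 ≤ e) (j : Fin (p ^ e)) :
    X ((attIdx p e).symm (1, j)) * X (att00 p e) ^ (j : ℕ) - X (att10 p e) * X (att01 (p := p) he) ^ (j : ℕ)
      ∈ attP F p e := by
  rw [mem_attP_iff, map_sub, map_mul, map_mul, map_pow, map_pow, attPsi_X, attPsi_X, attPsi_X, attPsi_X,
    attC_symm_apply, attC_att00, attC_att10, attC_att01]
  simp only [Fin.val_one, pow_one, map_one, one_mul, map_mul, map_pow, mul_pow]
  ring

/-- The additive relation `G_{10} = X_{10}^q − u_0 X_{00}^q ∈ attP`. [folklore] -/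
theorem G10_mem : X (att10 p e) ^ p ^ e - C (ratGen F 2 0) * X (att00 p e) ^ p ^ e ∈ attP F p e := by
  rw [mem_attP_iff, map_sub, map_mul, map_pow, map_pow, attPsi_X, attPsi_X, attPsi_C, attC_att00, attC_att10]
  simp only [map_one, one_mul, map_pow, mul_pow]
  ring

/-- The additive relation `G_{01} = X_{01}^q − u_1 X_{00}^q ∈ attP`. [folklore] -/
theorem G01_mem (he : 1 ≤ e) :
    X (att01 (p := p) he) ^ p ^ e - C (ratGen F 2 1) * X (att00 p e) ^ p ^ e ∈ attP F p e := by
  rw [mem_attP_iff, map_sub, map_mul, map_pow, map_pow, attPsi_X, attPsi_X, attPsi_C, attC_att00, attC_att01]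
  simp only [map_one, one_mul, map_pow, mul_pow]
  ring

/-- `att00 ≠ att01`. [folklore] -/
theorem att00_ne_att01 (he : 1 ≤ e) : att00 p e ≠ att01 (p := p) he := by
  unfold att00 att01
  intro h
  have := congrArg Prod.snd ((attIdx p e).symm.injective h)
  simp [Fin.ext_iff] at this

omit [CharP F p] in
/-- `G_{01} ≠ 0`. [folklore] -/
theorem G01_ne_zero (he : 1 ≤ e) :
    (X (att01 (p := p) he) ^ p ^ e - C (ratGen F 2 1) * X (att00 p e) ^ p ^ e :
      MvPolynomial (Fin (attN p e + 1)) (RatField F 2)) ≠ 0 := by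
  classical
  intro h
  have hq : p ^ e ≠ 0 := pow_ne_zero _ hp.out.ne_zero
  have hc := congrArg (coeff (Finsupp.single (att01 (p := p) he) (p ^ e))) h
  rw [coeff_sub, coeff_X_pow, if_pos rfl, coeff_C_mul, coeff_X_pow, if_neg, mul_zero, sub_zero, coeff_zero] at hc
  · exact one_ne_zero hc
  · intro h'
    exact att00_ne_att01 (p := p) he ((Finsupp.single_left_inj hq).mp h')

/-- The geometric-sum identity in characteristic `p`:
`Σ_{j<q} u_1^{q−1−j} X_{00}^{q(q−1−j)} X_{01}^{qj} = G_{01}^{q−1}` (`Σ a^j b^{q−1−j} · (a − b) = a^q − b^q = (a−b)^q`).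
[folklore] -/
theorem geom_eq_G01_pow (he : 1 ≤ e) :
    (∑ j : Fin (p ^ e), C (ratGen F 2 1) ^ (p ^ e - 1 - j) * X (att00 p e) ^ (p ^ e * (p ^ e - 1 - j)) *
        X (att01 (p := p) he) ^ (p ^ e * j) : MvPolynomial (Fin (attN p e + 1)) (RatField F 2)) =
      (X (att01 (p := p) he) ^ p ^ e - C (ratGen F 2 1) * X (att00 p e) ^ p ^ e) ^ (p ^ e - 1) := by
  set a : MvPolynomial (Fin (attN p e + 1)) (RatField F 2) := X (att01 (p := p) he) ^ p ^ e with ha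
  set b : MvPolynomial (Fin (attN p e + 1)) (RatField F 2) := C (ratGen F 2 1) * X (att00 p e) ^ p ^ e with hb
  have hsum : (∑ j : Fin (p ^ e), C (ratGen F 2 1) ^ (p ^ e - 1 - j) * X (att00 p e) ^ (p ^ e * (p ^ e - 1 - j)) *
        X (att01 (p := p) he) ^ (p ^ e * j) : MvPolynomial (Fin (attN p e + 1)) (RatField F 2)) =
      ∑ j ∈ Finset.range (p ^ e), a ^ j * b ^ (p ^ e - 1 - j) := by
    rw [← Fin.sum_univ_eq_sum_range (fun j => a ^ j * b ^ (p ^ e - 1 - j))]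
    refine Finset.sum_congr rfl fun j _ => ?_
    rw [ha, hb, mul_pow, ← pow_mul, ← pow_mul, mul_comm (p ^ e) (j : ℕ)]
    ring
  rw [hsum]
  have hq1 : p ^ e = (p ^ e - 1) + 1 := (Nat.sub_add_cancel (Nat.one_le_pow _ _ hp.out.pos)).symm
  have key : (∑ j ∈ Finset.range (p ^ e), a ^ j * b ^ (p ^ e - 1 - j)) * (a - b) = (a - b) ^ (p ^ e - 1) * (a - b) := by
    rw [geom_sum₂_mul, ← sub_pow_char_pow, ← pow_succ, ← hq1]
  exact mul_right_cancel₀ (G01_ne_zero (p := p) he) key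

/-! ## The multiplicity computation -/

/-- `x − y ∈ attP ⇒ x^q ≡ y^q (mod attP^q)` (`x^q − y^q = (x − y)^q` in characteristic `p`). [folklore] -/
theorem mk_pow_eq_of_sub_mem {x y : MvPolynomial (Fin (attN p e + 1)) (RatField F 2)} (h : x - y ∈ attP F p e) :
    Ideal.Quotient.mk (attP F p e ^ p ^ e) x ^ p ^ e = Ideal.Quotient.mk (attP F p e ^ p ^ e) y ^ p ^ e := by
  rw [← map_pow, ← map_pow, Ideal.Quotient.eq, ← sub_pow_char_pow]
  exact Ideal.pow_mem_pow h _

/-- The additive form of `a⁰`, indexed by `(ε, j)`: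
`h⁰ = Σ_j (u_0 u_1^{q−1−j} X_{(0,j)}^q − u_1^{q−1−j} X_{(1,j)}^q)`. [cite: Mizutani1973HironakaGroupSchemes, Remark 2.10 (in-house proof §10: ω = t_0 t_1^{q−1})] -/
theorem addForm_attA0_eq :
    addForm (RatField F 2) p e (attA0 F p e) = ∑ j : Fin (p ^ e),
      (C (ratGen F 2 0 * ratGen F 2 1 ^ (p ^ e - 1 - j)) * X ((attIdx p e).symm (0, j)) ^ p ^ e -
        C (ratGen F 2 1 ^ (p ^ e - 1 - j)) * X ((attIdx p e).symm (1, j)) ^ p ^ e) := by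
  unfold addForm
  set g : Fin 2 × Fin (p ^ e) → MvPolynomial (Fin (attN p e + 1)) (RatField F 2) := fun x =>
    C (if x.1 = 0 then ratGen F 2 0 * ratGen F 2 1 ^ (p ^ e - 1 - x.2) else -(ratGen F 2 1 ^ (p ^ e - 1 - x.2))) *
      X ((attIdx p e).symm x) ^ p ^ e with hg
  have hA : ∑ j : Fin (p ^ e), g (0, j) = ∑ j : Fin (p ^ e),
      C (ratGen F 2 0 * ratGen F 2 1 ^ (p ^ e - 1 - j)) * X ((attIdx p e).symm (0, j)) ^ p ^ e :=
    Finset.sum_congr rfl fun j _ => by rw [hg]; dsimp only; rw [if_pos rfl]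
  have hB : ∑ j : Fin (p ^ e), g (1, j) = ∑ j : Fin (p ^ e),
      -(C (ratGen F 2 1 ^ (p ^ e - 1 - j)) * X ((attIdx p e).symm (1, j)) ^ p ^ e) :=
    Finset.sum_congr rfl fun j _ => by
      rw [hg]; dsimp only; rw [if_neg (show (1 : Fin 2) ≠ 0 by decide), map_neg]; ring
  rw [Fintype.sum_equiv (attIdx p e) (fun i => C (attA0 F p e i) * X i ^ p ^ e) g
      (fun i => by rw [hg]; dsimp only; rw [Equiv.symm_apply_apply]; unfold attA0; rfl),
    Fintype.sum_prod_type, Fin.sum_univ_two, hA, hB, Finset.sum_sub_distrib, sub_eq_add_neg,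
    ← Finset.sum_neg_distrib]

/-- **`X_{00}^{q²} · h⁰ ∈ attP^q`**: the additive form of `a⁰` has multiplicity `q = p^e` at `attP`
(`X_{00}^{q²} h⁰ ≡ −X_{00}^q · G_{10} G_{01}^{q−1}` modulo `q`-th powers of elements of `attP`).
[cite: Mizutani1973HironakaGroupSchemes, §1 Def. 1.1 (U_q(𝔭)) and Remark 2.10] -/
theorem X00_pow_mul_addForm_attA0_mem (he : 1 ≤ e) :
    X (att00 p e) ^ (p ^ e * p ^ e) * addForm (RatField F 2) p e (attA0 F p e) ∈ attP F p e ^ p ^ e := by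
  have hq : 1 ≤ p ^ e := Nat.one_le_pow _ _ hp.out.pos
  rw [← Ideal.Quotient.eq_zero_iff_mem, map_mul, map_pow]
  set π := Ideal.Quotient.mk (attP F p e ^ p ^ e) with hπ
  set Y : MvPolynomial (Fin (attN p e + 1)) (RatField F 2) := X (att00 p e) with hY
  set X10 : MvPolynomial (Fin (attN p e + 1)) (RatField F 2) := X (att10 p e) with hX10
  set X01 : MvPolynomial (Fin (attN p e + 1)) (RatField F 2) := X (att01 (p := p) he) with hX01
  -- per-index identities in `S / attP^q`
  have h0 : ∀ j : Fin (p ^ e), π Y ^ (p ^ e * p ^ e) * π (X ((attIdx p e).symm (0, j))) ^ p ^ e =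
      (π X01 ^ (j : ℕ) * π Y) ^ p ^ e * π Y ^ (p ^ e * (p ^ e - 1 - j) + p ^ e) := by
    intro j
    have hd : (j : ℕ) + (p ^ e - 1 - j) + 1 = p ^ e := by omega
    have eS : Y ^ (p ^ e * p ^ e) * X ((attIdx p e).symm (0, j)) ^ p ^ e =
        (X ((attIdx p e).symm (0, j)) * Y ^ (j : ℕ)) ^ p ^ e * Y ^ (p ^ e * (p ^ e - 1 - j) + p ^ e) := by
      conv_lhs => rw [show p ^ e * p ^ e = p ^ e * ((j : ℕ) + (p ^ e - 1 - j) + 1) by rw [hd]]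
      ring
    have f0 := mk_pow_eq_of_sub_mem (binom0_mem (F := F) he j)
    have eS' := congrArg π eS
    simp only [map_mul, map_pow] at eS' f0
    rw [f0] at eS'
    exact eS'
  have h1 : ∀ j : Fin (p ^ e), π Y ^ (p ^ e * p ^ e) * π (X ((attIdx p e).symm (1, j))) ^ p ^ e =
      (π X10 * π X01 ^ (j : ℕ)) ^ p ^ e * π Y ^ (p ^ e * (p ^ e - 1 - j) + p ^ e) := by
    intro j
    have hd : (j : ℕ) + (p ^ e - 1 - j) + 1 = p ^ e := by omega
    have eS : Y ^ (p ^ e * p ^ e) * X ((attIdx p e).symm (1, j)) ^ p ^ e =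
        (X ((attIdx p e).symm (1, j)) * Y ^ (j : ℕ)) ^ p ^ e * Y ^ (p ^ e * (p ^ e - 1 - j) + p ^ e) := by
      conv_lhs => rw [show p ^ e * p ^ e = p ^ e * ((j : ℕ) + (p ^ e - 1 - j) + 1) by rw [hd]]
      ring
    have f1 := mk_pow_eq_of_sub_mem (binom1_mem (F := F) he j)
    have eS' := congrArg π eS
    simp only [map_mul, map_pow] at eS' f1
    rw [f1] at eS'
    exact eS'
  -- summing up
  have hsum : π Y ^ (p ^ e * p ^ e) * π (addForm (RatField F 2) p e (attA0 F p e)) =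
      -(π (X10 ^ p ^ e - C (ratGen F 2 0) * Y ^ p ^ e) * π Y ^ p ^ e *
        π (∑ j : Fin (p ^ e), C (ratGen F 2 1) ^ (p ^ e - 1 - j) * Y ^ (p ^ e * (p ^ e - 1 - j)) *
          X01 ^ (p ^ e * j))) := by
    rw [addForm_attA0_eq, map_sum, Finset.mul_sum, map_sum, Finset.mul_sum, ← Finset.sum_neg_distrib]
    refine Finset.sum_congr rfl fun j _ => ?_
    simp only [map_sub, map_mul, map_pow]
    linear_combination (π (C (ratGen F 2 0)) * π (C (ratGen F 2 1)) ^ (p ^ e - 1 - (j : ℕ))) * h0 j -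
      π (C (ratGen F 2 1)) ^ (p ^ e - 1 - (j : ℕ)) * h1 j
  rw [hsum, geom_eq_G01_pow he, neg_eq_zero, ← map_pow, ← map_mul, ← map_mul, Ideal.Quotient.eq_zero_iff_mem]
  have hmem : (X10 ^ p ^ e - C (ratGen F 2 0) * Y ^ p ^ e) *
      (X01 ^ p ^ e - C (ratGen F 2 1) * Y ^ p ^ e) ^ (p ^ e - 1) ∈ attP F p e ^ p ^ e := by
    have h := Ideal.mul_mem_mul (G10_mem (F := F) (p := p) (e := e))
      (Ideal.pow_mem_pow (G01_mem (F := F) he) (p ^ e - 1))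
    rwa [← pow_succ', Nat.sub_add_cancel hq] at h
  have : (X10 ^ p ^ e - C (ratGen F 2 0) * Y ^ p ^ e) * Y ^ p ^ e *
      (X01 ^ p ^ e - C (ratGen F 2 1) * Y ^ p ^ e) ^ (p ^ e - 1) =
      Y ^ p ^ e * ((X10 ^ p ^ e - C (ratGen F 2 0) * Y ^ p ^ e) *
        (X01 ^ p ^ e - C (ratGen F 2 1) * Y ^ p ^ e) ^ (p ^ e - 1)) := by ring
  rw [this]
  exact Ideal.mul_mem_left _ _ hmem

/-- **`a⁰ ∈ U(attP) ∩ L_e`** (Hironaka's reading): the additive form `Σ a⁰_i X_i^{p^e}` lies in the symbolic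
power `attP^{(p^e)}` (witness `s = X_{00}^{q²} ∉ attP`). [cite: Mizutani1973HironakaGroupSchemes, §1 (Def. 1.1, (c)) and Remark 2.10] -/
theorem attA0_mem_hirForms (he : 1 ≤ e) :
    attA0 F p e ∈ hirForms (h𝔭 := attP_isPrime) (RatField F 2) p (attP F p e) e :=
  ⟨X (att00 p e) ^ (p ^ e * p ^ e), fun h => X_att00_not_mem (attP_isPrime.mem_of_pow_mem _ h),
    X00_pow_mul_addForm_attA0_mem he⟩

/-! ## Oda's equality `U(attP) ∩ L = L_B(attP)` at every level -/

/-- `F^m (L_B)_{e'} ⊆ (L_B)_{e'+m}` for `attP` (iterated `F`-stability). [cite: Oda1983HironakaGroupSchemeII, §2 (p. 1168: L_B is a k[F]-submodule)] -/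
theorem frobVec_mem_invForms_attP (m : ℕ) {e' : ℕ} {a : Fin (attN p e + 1) → RatField F 2}
    (ha : a ∈ invForms (RatField F 2) p (attP F p e) e') :
    frobVec (RatField F 2) p m a ∈ invForms (RatField F 2) p (attP F p e) (e' + m) := by
  induction m with
  | zero => rw [funext (frobVec_zero (RatField F 2) p) |> congrFun <| a]; simpa using ha
  | succ m ih =>
    have h := frobVec_one_mem_invForms (RatField F 2) p (attP F p e) attP_ne_top ih
    rw [frobVec_frobVec] at h
    exact h

/-- **Below the exponent there are no invariant forms**: `(L_B)_{e'}(attP) = 0` for `e' < e` (a nonzero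
`a ∈ (L_B)_{e'}` would give `F^{e−e'} a ∈ (L_B)_e = k·a⁰`, so `a⁰` would be proportional to a vector of `p`-th
powers; but `a⁰_{i*} = −1`, `a⁰_{i₂} = −u_1` and `u_1 ∉ k^p`). [cite: Mizutani1973HironakaGroupSchemes, Remark 2.10 (e(H_e) = e)] -/
theorem invForms_attP_eq_bot_of_lt (hF : ∀ c : F, c ^ p = c) {e' : ℕ} (hlt : e' < e) :
    invForms (RatField F 2) p (attP F p e) e' = ⊥ := by
  have he : 1 ≤ e := by omega
  set K := RatField F 2 with hK
  obtain ⟨m, hm⟩ : ∃ m, e = e' + (m + 1) := ⟨e - e' - 1, by omega⟩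
  rw [eq_bot_iff]
  intro a ha
  rw [Submodule.mem_bot]
  by_contra ha0
  -- `b = F^{m+1} a ∈ (L_B)_e`, nonzero
  have hb : frobVec K p (m + 1) a ∈ invForms K p (attP F p e) e := by
    have h := frobVec_mem_invForms_attP (F := F) (m + 1) ha
    rw [← hm] at h
    exact h
  have hb0 : frobVec K p (m + 1) a ≠ 0 := by
    intro h0
    apply ha0
    funext i
    have := congrFun h0 i
    simp only [frobVec, Pi.zero_apply] at this
    exact (pow_eq_zero_iff (pow_ne_zero _ hp.out.ne_zero)).mp this
  -- both `b` and `a⁰` lie on the line `k · attV 0`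
  have hle := invForms_attP_le_span (F := F) (p := p) (e := e) hF he 0
  obtain ⟨lam, hlam⟩ := Submodule.mem_span_singleton.mp (hle (by simpa using hb))
  obtain ⟨mu, hmu⟩ := Submodule.mem_span_singleton.mp (hle (by simpa using attA0_mem_invForms hF he))
  have hmu0 : mu ≠ 0 := by
    rintro rfl; rw [zero_smul] at hmu; exact attA0_ne_zero hmu.symm
  have hlam0 : lam ≠ 0 := by
    rintro rfl; rw [zero_smul] at hlam; exact hb0 hlam.symm
  have hprop : frobVec K p (m + 1) a = (lam * mu⁻¹) • attA0 F p e := by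
    rw [← hlam, ← hmu, smul_smul, mul_assoc, inv_mul_cancel₀ hmu0, mul_one]
  have h1 := congrFun hprop attTop
  have h2 := congrFun hprop (attTop' he)
  simp only [frobVec, Pi.smul_apply, attA0_attTop, smul_eq_mul, mul_neg, mul_one] at h1
  simp only [frobVec, Pi.smul_apply, attA0_attTop' he, smul_eq_mul, mul_neg] at h2
  have hb1 : a attTop ≠ 0 := by
    intro h0
    rw [h0, zero_pow (pow_ne_zero _ hp.out.ne_zero)] at h1
    exact (mul_ne_zero hlam0 (inv_ne_zero hmu0)) (neg_eq_zero.mp h1.symm)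
  have hu1 : ratGen F 2 1 = ((a (attTop' he) / a attTop) ^ p ^ m) ^ p := by
    rw [← pow_mul, ← pow_succ, div_pow, h2, h1]
    field_simp
  exact ratGen_not_mem_frobPow (F := F) (s := 2) (p := p) 1
    (mem_frobPow_iff.mpr ⟨_, by rw [pow_one]; exact hu1.symm⟩)

/-- **At the exponent level: `U(attP) ∩ L_e = (L_B)_e(attP)`** (both are the line `k · a⁰`).
[cite: Mizutani1973HironakaGroupSchemes, §1 (c) and Remark 2.10] -/
theorem hirForms_attP_eq_level (hF : ∀ c : F, c ^ p = c) (he : 1 ≤ e) :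
    hirForms (h𝔭 := attP_isPrime) (RatField F 2) p (attP F p e) e = invForms (RatField F 2) p (attP F p e) e := by
  haveI : (attP F p e).IsPrime := attP_isPrime
  refine Submodule.eq_of_le_of_finrank_le (hirForms_le_invForms (attP F p e) e) ?_
  rw [finrank_invForms_attP hF he]
  have hle : Submodule.span (RatField F 2) {attA0 F p e} ≤ hirForms (RatField F 2) p (attP F p e) e := by
    rw [Submodule.span_le, Set.singleton_subset_iff]
    exact attA0_mem_hirForms he
  have h := Submodule.finrank_mono hle
  rwa [finrank_span_singleton attA0_ne_zero] at h

/-- **Oda's equality holds for Mizutani's `H_e` at EVERY level**: `U(attP) ∩ L_j = (L_B)_j(attP)` for all `j`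
(levels `≥ e` by `hirForms_eq_invForms_of_exponentLE`, levels `< e` because both vanish).
[cite: Oda1983HironakaGroupSchemeII, §2 (p. 1168: Oda 1973 Prop. 2.2 (ii)); Mizutani1973HironakaGroupSchemes, Remark 2.10] -/
theorem hirForms_attP_eq (hF : ∀ c : F, c ^ p = c) (he : 1 ≤ e) (j : ℕ) :
    hirForms (h𝔭 := attP_isPrime) (RatField F 2) p (attP F p e) j = invForms (RatField F 2) p (attP F p e) j := by
  haveI : (attP F p e).IsPrime := attP_isPrime
  rcases Nat.lt_or_ge j e with hj | hj
  · apply le_antisymm (hirForms_le_invForms (attP F p e) j)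
    rw [invForms_attP_eq_bot_of_lt hF hj]
    exact bot_le
  · exact hirForms_eq_invForms_of_exponentLE (exponentLE_attP hF he) (hirForms_attP_eq_level hF he) hj

end Attained

/-! ## The attainment in Hironaka's reading -/

section Assembly

/-- **ATTAINMENT `m(e) ≤ 2p^e − 1` with Hironaka's own invariant forms**: for every prime `p` and every `e` there is
a point `𝔭` of some `ℙ^n_k` (`char k = p`) at which Oda's `(L_B)_j` and Hironaka's `U(𝔭) ∩ L_j` COINCIDE at every
level `j` — so exponent and dimension mean the same in both readings — with exponent exactly `e` and
`dim B(𝔭) = 2p^e − 1`: Mizutani's `H_e` (`attP`, `e ≥ 1`) resp. a rational point (`e = 0`).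
[cite: Mizutani1973HironakaGroupSchemes, Remark 2.10 (the schemes H_e) and §1 (c) (exponent via U(𝔭) ∩ L)] -/
theorem mizutaniAttained_hirForms (p : ℕ) [Fact p.Prime] (e : ℕ) :
    ∃ (k : Type u) (_ : Field k) (_ : CharP k p) (n : ℕ) (𝔭 : Ideal (MvPolynomial (Fin (n + 1)) k))
      (h𝔭 : 𝔭.IsPrime), IsPoint k 𝔭 ∧ (∀ j, hirForms (h𝔭 := h𝔭) k p 𝔭 j = invForms k p 𝔭 j) ∧
        ExponentLE k p 𝔭 e ∧ (∀ e', e' < e → ¬ ExponentLE k p 𝔭 e') ∧ hsDimAt k p 𝔭 e + 1 = 2 * p ^ e := by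
  rcases Nat.eq_zero_or_pos e with rfl | he
  · obtain ⟨k, _, _, n, 𝔭, hP, hE, hlt, hdim⟩ := mizutaniAttained_zero.{u} p
    exact ⟨k, inferInstance, inferInstance, n, 𝔭, hP.1, hP,
      fun j => hirForms_eq_invForms_of_exponentLE_zero (h𝔭 := hP.1) hE j, hE, hlt, hdim⟩
  · set F := ULift.{u} (ZMod p)
    have hF : ∀ c : F, c ^ p = c := ulift_zmod_pow_char p
    obtain ⟨e', rfl⟩ : ∃ e', e = e' + 1 := ⟨e - 1, by omega⟩
    exact ⟨RatField F 2, inferInstance, inferInstance, attN p (e' + 1), attP F p (e' + 1), attP_isPrime, isPoint_attP,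
      hirForms_attP_eq hF he, exponentLE_attP hF he,
      fun e'' he'' hE => not_exponentLE_attP hF rfl (hE.mono (by omega)), hsDimAt_attP hF he⟩

end Assembly

end Summit.ResolutionOfSingularities.KangarooAtlas.Mizutani
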